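import Summits.RiemannHypothesis.RiemannHypothesis.Theorems.LiTailLaguerreFejerPieces
import Literature.Analysis.Fourier.FresnelConstantValue
import HarnessLib

/-!
# RiemannHypothesis / LiTailLaguerre — Fejér companion, part 3: the Laguerre bridge integral to bounded error (RH-FREE)

RH-FREE [rh-li-eng].  Cell `pub/rh-li`, round 7; sequel to `Theorems/LiTailLaguerreFejerPieces.lean`.  THE ANALYTIC
CORE of the Fejér companion: for fixed `y > 0` and every `n ≥ max(2y, 4/y, 1)`,

  `| ∫_0^∞ 2(1 − cos nθ(t)) cos(ty) dt + √π · √n/(y (n/y)^{1/4}) · cos(2√(ny) + π/4) | ≤ 2 + 4·10⁹/y + 2√y + 1/√y`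

(`bridge_asymptotic`; `√n/(y (n/y)^{1/4}) = n^{1/4} y^{−3/4}`).  Since the integral is `π e^{−y/2} L¹_{n−1}(y)` (tree
theorem `Literature.Analysis.SpecialFunctions.integral_liKernel_mul_cos_Ioi`), this is FEJÉR'S FORMULA
`e^{−y/2} L¹_{n−1}(y) = π^{−1/2} y^{−3/4} n^{1/4} cos(2√(ny) − 3π/4) + O_y(1)` with a bounded (not `o(1)`) error —
Fejér 1909 / Szegő, *Orthogonal Polynomials*, Thm 8.22.1 (`α = 1`) has `O(n^{−1/4})`, which needs a second-order
stationary phase; the bounded form is what the LI column's ECHO companion consumes.  Assembly: `∫_0^∞ = ∫_0^{n²} + O(1)`;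
`∫_0^{n²} = 2 sin(n²y)/y − Re∫e^{iF} − Re∫e^{iG}`; `∫e^{iG}`, `∫_0^{t₀/2} e^{iF}`, `∫_{2t₀}^{n²} e^{iF}` are `O(1/y)`
(first-derivative test); `∫_{t₀/2}^{2t₀} e^{iF} = 𝔣 e^{iF(t₀)} F''(t₀)^{−1/2} + O(1/y)` (Graham–Kolesnik 3.4) with
`Re 𝔣 e^{iF(t₀)} F''(t₀)^{−1/2} = √π √n/(y√t₀) · cos(F(t₀) + π/4)` (`fresnelC_eq`), `|F(t₀) − 2√(ny)| ≤ y/(4t₀) + n/(12t₀³)`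
and `|√n/(y√t₀) − √n/(y (n/y)^{1/4})| ≤ 1/(5√(πy))`.  Nothing here bears on the truth of RH.
-/

noncomputable section

-- D-0017: `Summit.<S>.<S>.…` is the designed namespace of a single-problem summit.
set_option linter.dupNamespace false

open Set MeasureTheory intervalIntegral Complex
open Literature.Analysis.Fourier

namespace Summit.RiemannHypothesis.RiemannHypothesis.Theorems.LiTheory

namespace Fejer

/-! ### The main term: real part and amplitude -/

/-- Real part of the Graham–Kolesnik main term: `Re(𝔣 e^{iθ} r) = √(2π) r cos(θ + π/4)`. -/
theorem re_fresnel_main (θ r : ℝ) :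
    (fresnelC * cexp (I * θ) * (r : ℂ)).re = Real.sqrt (2 * Real.pi) * r * Real.cos (θ + Real.pi / 4) := by
  rw [fresnelC_eq]
  have e1 : cexp (((Real.pi / 4 : ℝ) : ℂ) * I) * cexp (I * (θ : ℂ)) = cexp (((θ + Real.pi / 4 : ℝ) : ℂ) * I) := by
    rw [← Complex.exp_add]
    congr 1
    push_cast
    ring
  have e2 : (Real.sqrt (2 * Real.pi) : ℂ) * cexp (((Real.pi / 4 : ℝ) : ℂ) * I) * cexp (I * (θ : ℂ)) * (r : ℂ)
      = ((Real.sqrt (2 * Real.pi) * r : ℝ) : ℂ) * cexp (((θ + Real.pi / 4 : ℝ) : ℂ) * I) := by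
    rw [mul_assoc (Real.sqrt (2 * Real.pi) : ℂ), e1]
    push_cast
    ring
  rw [e2, Complex.re_ofReal_mul, Complex.exp_ofReal_mul_I_re]

/-- The amplitude: `√(2π) F''(t₀)^{−1/2} = √π √n/(y √t₀)`. -/
theorem amp_eq {n : ℕ} {y : ℝ} (hy : 0 < y) (hn : 2 * y ≤ n) :
    Real.sqrt (2 * Real.pi) * (Real.sqrt (phF2 n (tz n y)))⁻¹
      = Real.sqrt Real.pi * Real.sqrt n / (y * Real.sqrt (tz n y)) := by
  rw [phF2_tz hy hn]
  have ht := tz_pos hy hn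
  have hn0 : (0 : ℝ) < n := by
    have : (0 : ℝ) < 2 * y := by positivity
    linarith
  rw [Real.sqrt_div (by positivity : (0 : ℝ) ≤ 2 * tz n y * y ^ 2),
    Real.sqrt_mul (by positivity : (0 : ℝ) ≤ 2 * tz n y), Real.sqrt_sq hy.le,
    Real.sqrt_mul (by norm_num : (0 : ℝ) ≤ 2), Real.sqrt_mul (by norm_num : (0 : ℝ) ≤ 2)]
  have h2 : Real.sqrt 2 ≠ 0 := by positivity
  have h3 : Real.sqrt (tz n y) ≠ 0 := (Real.sqrt_pos.2 ht).ne'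
  have h4 : Real.sqrt n ≠ 0 := (Real.sqrt_pos.2 hn0).ne'
  field_simp

/-- `√π √(2y) ≤ 3 √y` (`2π ≤ 9`). -/
theorem sqrt_pi_mul_sqrt_two_mul_le (y : ℝ) :
    Real.sqrt Real.pi * Real.sqrt (2 * y) ≤ 3 * Real.sqrt y := by
  rw [Real.sqrt_mul (by norm_num : (0 : ℝ) ≤ 2) y, ← mul_assoc, ← Real.sqrt_mul Real.pi_pos.le 2]
  gcongr
  rw [show (3 : ℝ) = Real.sqrt (3 ^ 2) by rw [Real.sqrt_sq (by norm_num)]]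
  exact Real.sqrt_le_sqrt (by nlinarith [Real.pi_lt_d2])

/-- The phase-comparison cost: `A (y/(4t₀) + n/(12t₀³)) ≤ (5/4)√y`, `A = √π√n/(y√t₀)`. -/
theorem amp_phase_le {n : ℕ} {y : ℝ} (hy : 0 < y) (hn : 2 * y ≤ n) :
    Real.sqrt Real.pi * Real.sqrt n / (y * Real.sqrt (tz n y)) * (y / (4 * tz n y) + n / (12 * tz n y ^ 3))
      ≤ 5 / 4 * Real.sqrt y := by
  obtain ⟨_, h1, _, hny⟩ := tz_facts hy hn
  have hs0 : 0 < tz n y := by linarith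
  have hn2 : (n : ℝ) ≤ 2 * y * tz n y ^ 2 := by rw [hny]; nlinarith
  have hsn : Real.sqrt n ≤ Real.sqrt (2 * y) * tz n y := by
    calc Real.sqrt n ≤ Real.sqrt (2 * y * tz n y ^ 2) := Real.sqrt_le_sqrt hn2
      _ = Real.sqrt (2 * y) * tz n y := by rw [Real.sqrt_mul (by positivity), Real.sqrt_sq hs0.le]
  have hss : 1 ≤ Real.sqrt (tz n y) := by rw [← Real.sqrt_one]; exact Real.sqrt_le_sqrt h1
  have hsqπ := sqrt_pi_mul_sqrt_two_mul_le y
  have hss0 : 0 < Real.sqrt (tz n y) := by linarith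
  calc Real.sqrt Real.pi * Real.sqrt n / (y * Real.sqrt (tz n y)) * (y / (4 * tz n y) + n / (12 * tz n y ^ 3))
      ≤ Real.sqrt Real.pi * Real.sqrt n / (y * Real.sqrt (tz n y))
          * (y / (4 * tz n y) + 2 * y * tz n y ^ 2 / (12 * tz n y ^ 3)) := by gcongr
    _ = 5 * (Real.sqrt Real.pi * Real.sqrt n) / (12 * tz n y * Real.sqrt (tz n y)) := by
        field_simp; ring
    _ ≤ 5 * (Real.sqrt Real.pi * (Real.sqrt (2 * y) * tz n y)) / (12 * tz n y * Real.sqrt (tz n y)) := by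
        gcongr
    _ = 5 * (Real.sqrt Real.pi * Real.sqrt (2 * y)) / (12 * Real.sqrt (tz n y)) := by
        field_simp
    _ ≤ 5 * (3 * Real.sqrt y) / (12 * 1) := by gcongr
    _ = 5 / 4 * Real.sqrt y := by ring

/-- The amplitude comparison: `|√π√n/(y√t₀) − √π√n/(y (n/y)^{1/4})| ≤ 1/(5√y)`
(`t₁ = √(n/y)`: `t₁² = t₀² + ¼`, `t₁ − t₀ ≤ 1/8`, `√t₁ − √t₀ ≤ 1/16`, `√n ≤ √(2y) t₀`). -/
theorem amp_sub_le {n : ℕ} {y : ℝ} (hy : 0 < y) (hn : 2 * y ≤ n) :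
    |Real.sqrt Real.pi * Real.sqrt n / (y * Real.sqrt (tz n y))
        - Real.sqrt Real.pi * Real.sqrt n / (y * Real.sqrt (Real.sqrt (n / y)))| ≤ 1 / (5 * Real.sqrt y) := by
  obtain ⟨hsq, h1, _, hny⟩ := tz_facts hy hn
  have hs0 : 0 < tz n y := by linarith
  have hn0 : (0 : ℝ) < n := by
    have : (0 : ℝ) < 2 * y := by positivity
    linarith
  set s := tz n y with hs
  set t₁ := Real.sqrt (n / y) with ht₁
  have ht1sq : t₁ ^ 2 = s ^ 2 + 1 / 4 := by rw [ht₁, Real.sq_sqrt (by positivity), hsq]; ring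
  have ht1pos : 0 < t₁ := Real.sqrt_pos.2 (by positivity)
  have hst : s ≤ t₁ := by nlinarith
  have ht11 : 1 ≤ t₁ := h1.trans hst
  have hdiff : t₁ - s ≤ 1 / 8 := by nlinarith
  -- square roots
  have hσs : 1 ≤ Real.sqrt s := by rw [← Real.sqrt_one]; exact Real.sqrt_le_sqrt h1
  have hσt : 1 ≤ Real.sqrt t₁ := by rw [← Real.sqrt_one]; exact Real.sqrt_le_sqrt ht11
  have hσle : Real.sqrt s ≤ Real.sqrt t₁ := Real.sqrt_le_sqrt hst
  have hσ : Real.sqrt t₁ - Real.sqrt s ≤ 1 / 16 := by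
    have e : (Real.sqrt t₁ - Real.sqrt s) * (Real.sqrt t₁ + Real.sqrt s) = t₁ - s := by
      nlinarith [Real.sq_sqrt ht1pos.le, Real.sq_sqrt hs0.le]
    nlinarith
  have hden : s ≤ Real.sqrt s * Real.sqrt t₁ := by
    calc s = Real.sqrt s * Real.sqrt s := (Real.mul_self_sqrt hs0.le).symm
      _ ≤ Real.sqrt s * Real.sqrt t₁ := by gcongr
  have hσs0 : 0 < Real.sqrt s := by linarith
  have hσt0 : 0 < Real.sqrt t₁ := by linarith
  have hinv : 1 / Real.sqrt s - 1 / Real.sqrt t₁ ≤ 1 / (16 * s) := by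
    rw [div_sub_div _ _ hσs0.ne' hσt0.ne', one_mul, mul_one]
    calc (Real.sqrt t₁ - Real.sqrt s) / (Real.sqrt s * Real.sqrt t₁) ≤ (1 / 16) / s :=
          div_le_div₀ (by norm_num) hσ hs0 hden
      _ = 1 / (16 * s) := by field_simp
  have hinv0 : 0 ≤ 1 / Real.sqrt s - 1 / Real.sqrt t₁ := by
    rw [sub_nonneg]; exact one_div_le_one_div_of_le hσs0 hσle
  have hsn : Real.sqrt n ≤ Real.sqrt (2 * y) * s := by
    have hn2 : (n : ℝ) ≤ 2 * y * s ^ 2 := by rw [hny]; nlinarith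
    calc Real.sqrt n ≤ Real.sqrt (2 * y * s ^ 2) := Real.sqrt_le_sqrt hn2
      _ = Real.sqrt (2 * y) * s := by rw [Real.sqrt_mul (by positivity), Real.sqrt_sq hs0.le]
  have hsqπ := sqrt_pi_mul_sqrt_two_mul_le y
  have hsy : 0 < Real.sqrt y := Real.sqrt_pos.2 hy
  have e : Real.sqrt Real.pi * Real.sqrt n / (y * Real.sqrt s) - Real.sqrt Real.pi * Real.sqrt n / (y * Real.sqrt t₁)
      = Real.sqrt Real.pi * Real.sqrt n / y * (1 / Real.sqrt s - 1 / Real.sqrt t₁) := by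
    field_simp
  rw [e, abs_of_nonneg (by positivity)]
  calc Real.sqrt Real.pi * Real.sqrt n / y * (1 / Real.sqrt s - 1 / Real.sqrt t₁)
      ≤ Real.sqrt Real.pi * (Real.sqrt (2 * y) * s) / y * (1 / (16 * s)) := by gcongr
    _ = Real.sqrt Real.pi * Real.sqrt (2 * y) / (16 * y) := by field_simp
    _ ≤ 3 * Real.sqrt y / (16 * y) := by gcongr
    _ = 3 / (16 * Real.sqrt y) := by
        rw [div_eq_div_iff (by positivity) (by positivity)]
        nlinarith [Real.mul_self_sqrt hy.le]
    _ ≤ 1 / (5 * Real.sqrt y) := by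
        rw [div_le_div_iff₀ (by positivity) (by positivity)]
        nlinarith

/-! ### The bridge integral to bounded error -/

/-- **The Laguerre bridge integral to bounded error (Fejér's asymptotic, weak form).**  For `0 < y` and
`n ≥ max(2y, 4/y, 1)`:
`|∫_0^∞ 2(1 − cos nθ(t)) cos(ty) dt + √π √n/(y (n/y)^{1/4}) cos(2√(ny) + π/4)| ≤ 2 + 4·10⁹/y + 2√y + 1/√y`
(`√n/(y (n/y)^{1/4}) = n^{1/4} y^{−3/4}`; the integral is `π e^{−y/2} L¹_{n−1}(y)`).  Weak form of Fejér 1909 /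
Szegő Thm 8.22.1 (`α = 1`), proved here by first-order stationary phase. -/
theorem bridge_asymptotic {y : ℝ} (hy : 0 < y) {n : ℕ} (hn : 2 * y ≤ n) (hn' : 4 / y ≤ n) (hn1 : 1 ≤ n) :
    |(∫ t in Ioi (0 : ℝ), 2 * (1 - Real.cos (n * liZeroAngle t)) * Real.cos (t * y))
        + Real.sqrt Real.pi * Real.sqrt n / (y * Real.sqrt (Real.sqrt (n / y)))
            * Real.cos (2 * Real.sqrt (n * y) + Real.pi / 4)|
      ≤ 2 + 4 * 10 ^ 9 / y + 2 * Real.sqrt y + 1 / Real.sqrt y := by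
  obtain ⟨hsq, h1, _, _⟩ := tz_facts hy hn
  have hn0 : (0 : ℝ) < n := by exact_mod_cast (show 0 < n by omega)
  have ht0 : 0 < tz n y := by linarith
  -- the cut `L = n²`
  set L : ℝ := (n : ℝ) ^ 2 with hLdef
  have hL0 : 0 < L := by positivity
  have hL2 : 2 * tz n y ≤ L := by
    have h4 : (2 * tz n y) ^ 2 ≤ L ^ 2 := by
      rw [mul_pow, hsq, hLdef]
      have ha : 4 * (n : ℝ) / y ≤ (n : ℝ) ^ 2 := by
        have := mul_le_mul_of_nonneg_left hn' hn0.le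
        have e : (n : ℝ) * (4 / y) = 4 * n / y := by ring
        nlinarith
      have hn1' : (1 : ℝ) ≤ n := by exact_mod_cast hn1
      have hsq1 : (1 : ℝ) ≤ (n : ℝ) ^ 2 := by nlinarith
      have hb : (n : ℝ) ^ 2 ≤ ((n : ℝ) ^ 2) ^ 2 := by
        rw [pow_two ((n : ℝ) ^ 2)]
        exact le_mul_of_one_le_right (by positivity) hsq1
      have e : (2 : ℝ) ^ 2 * (n / y - 1 / 4) = 4 * n / y - 1 := by ring
      rw [e]
      linarith
    exact (pow_le_pow_iff_left₀ (by positivity) hL0.le two_ne_zero).1 h4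
  -- the decomposition
  rw [bridge_split n y hL0.le, bridge_trunc_eq n hy hL0.le]
  set I1 := ∫ t in (0 : ℝ)..(tz n y / 2), cexp (I * phF n y t) with hI1def
  set I2 := ∫ t in (tz n y / 2)..(2 * tz n y), cexp (I * phF n y t) with hI2def
  set I3 := ∫ t in (2 * tz n y)..L, cexp (I * phF n y t) with hI3def
  set IG := ∫ t in (0 : ℝ)..L, cexp (I * phG n y t) with hIGdef
  set T := ∫ t in Ioi L, 2 * (1 - Real.cos (n * liZeroAngle t)) * Real.cos (t * y) with hTdef
  set M := fresnelC * cexp (I * phF n y (tz n y)) * ((Real.sqrt (phF2 n (tz n y)))⁻¹ : ℝ) with hMdef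
  set A := Real.sqrt Real.pi * Real.sqrt n / (y * Real.sqrt (tz n y)) with hAdef
  set A' := Real.sqrt Real.pi * Real.sqrt n / (y * Real.sqrt (Real.sqrt (n / y))) with hA'def
  set φ := phF n y (tz n y) + Real.pi / 4 with hφdef
  set ψ := 2 * Real.sqrt (n * y) + Real.pi / 4 with hψdef
  have hIF : (∫ t in (0 : ℝ)..L, cexp (I * phF n y t)) = I1 + I2 + I3 := by
    have hi : ∀ a b : ℝ, IntervalIntegrable (fun t ↦ cexp (I * phF n y t)) volume a b := fun a b ↦
      (Complex.continuous_exp.comp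
        (continuous_const.mul (Complex.continuous_ofReal.comp (continuous_phF n y)))).intervalIntegrable a b
    rw [integral_add_adjacent_intervals (hi _ _) (hi _ _), integral_add_adjacent_intervals (hi _ _) (hi _ _)]
  -- the bounds on the pieces
  have hT : |T| ≤ 1 := (abs_bridge_tail_le n y hL0).trans (le_of_eq (div_self hL0.ne'))
  have r1 : |I1.re| ≤ 2 / y := (Complex.abs_re_le_norm _).trans (norm_left_piece hy hn)
  have r3 : |I3.re| ≤ 4 / y := (Complex.abs_re_le_norm _).trans (norm_right_piece hy hn hL2)
  have rG : |IG.re| ≤ 2 / y := (Complex.abs_re_le_norm _).trans (norm_G_piece n hy hL0.le)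
  have rE : |(I2 - M).re| ≤ 3 * 10 ^ 9 / y := (Complex.abs_re_le_norm _).trans (norm_stationary_piece hy hn)
  have hS : |2 * (Real.sin (L * y) / y)| ≤ 2 / y := by
    rw [abs_mul, abs_div, abs_of_pos hy, abs_two]
    have := Real.abs_sin_le_one (L * y)
    calc 2 * (|Real.sin (L * y)| / y) ≤ 2 * (1 / y) := by gcongr
      _ = 2 / y := by ring
  have hMre : M.re = A * Real.cos φ := by
    rw [hMdef, re_fresnel_main, amp_eq hy hn]
  have hI2re : I2.re = A * Real.cos φ + (I2 - M).re := by rw [Complex.sub_re, hMre]; ring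
  -- phase and amplitude comparisons
  have hA0 : 0 ≤ A := by positivity
  have hph : |Real.cos φ - Real.cos ψ| ≤ y / (4 * tz n y) + n / (12 * tz n y ^ 3) := by
    refine (Real.abs_cos_sub_cos_le _ _).trans ?_
    rw [hφdef, hψdef, show phF n y (tz n y) + Real.pi / 4 - (2 * Real.sqrt (n * y) + Real.pi / 4)
      = phF n y (tz n y) - 2 * Real.sqrt (n * y) by ring]
    exact abs_phF_tz_sub_le hy hn
  have hP : |A * Real.cos φ - A' * Real.cos ψ| ≤ 5 / 4 * Real.sqrt y + 1 / (5 * Real.sqrt y) := by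
    have e : A * Real.cos φ - A' * Real.cos ψ = A * (Real.cos φ - Real.cos ψ) + (A - A') * Real.cos ψ := by ring
    rw [e]
    refine (abs_add_le _ _).trans (add_le_add ?_ ?_)
    · rw [abs_mul, abs_of_nonneg hA0]
      exact (mul_le_mul_of_nonneg_left hph hA0).trans (amp_phase_le hy hn)
    · rw [abs_mul]
      calc |A - A'| * |Real.cos ψ| ≤ 1 / (5 * Real.sqrt y) * 1 :=
            mul_le_mul (amp_sub_le hy hn) (Real.abs_cos_le_one _) (abs_nonneg _) (by positivity)
        _ = 1 / (5 * Real.sqrt y) := mul_one _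
  -- assemble
  have hy1 : 0 < 1 / y := by positivity
  have hsy : 0 < Real.sqrt y := Real.sqrt_pos.2 hy
  have hsy1 : 0 < 1 / Real.sqrt y := by positivity
  have e5 : 1 / (5 * Real.sqrt y) = (1 / Real.sqrt y) / 5 := by field_simp
  rw [hIF, Complex.add_re, Complex.add_re, hI2re]
  have eX : 2 * (Real.sin (L * y) / y) - (I1.re + (A * Real.cos φ + (I2 - M).re) + I3.re) - IG.re + T
        + A' * Real.cos ψ
      = 2 * (Real.sin (L * y) / y) - I1.re - I3.re - IG.re - (I2 - M).re + T
        - (A * Real.cos φ - A' * Real.cos ψ) := by ring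
  rw [eX, abs_le]
  obtain ⟨a1, a2⟩ := abs_le.1 hT
  obtain ⟨b1, b2⟩ := abs_le.1 r1
  obtain ⟨c1, c2⟩ := abs_le.1 r3
  obtain ⟨d1, d2⟩ := abs_le.1 rG
  obtain ⟨f1, f2⟩ := abs_le.1 rE
  obtain ⟨g1, g2⟩ := abs_le.1 hS
  obtain ⟨p1, p2⟩ := abs_le.1 hP
  rw [e5] at p1 p2
  have h10 : (2 : ℝ) / y + 4 / y + 2 / y + 3 * 10 ^ 9 / y + 2 / y ≤ 4 * 10 ^ 9 / y := by
    rw [show (2 : ℝ) / y + 4 / y + 2 / y + 3 * 10 ^ 9 / y + 2 / y = (3 * 10 ^ 9 + 10) / y by ring]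
    gcongr
    norm_num
  constructor <;> linarith

end Fejer

end Summit.RiemannHypothesis.RiemannHypothesis.Theorems.LiTheory

end
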